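import Literature.Geometry.Kaehler.ComplexTorusPicardNumberSecondGap
import HarnessLib

/-!
# Hulek–Laface 2019, Remark 6.5: every Picard number `g ≤ ρ ≤ 2g` is attained by a product of `g`
# elliptic curves (explicit Poincaré decompositions `E_θ^b × ∏ E_{i√p_j}² × ∏ E_{i√p_k}`)

Layer `Literature/Geometry/Kaehler`, namespace `Literature.Geometry.Kaehler.ComplexTorus`; lane
`lit-hodgefound` (Track 2 foundations library), Layer A4 row A4-13 (self-proposed 2026-08-22, seat
`lit-hodgefound-p18`, generation 6, row g6-#3). Sequel of `ComplexTorusPicardNumberPoincareLength.lean`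
(Cor. 2.3 as printed: `ρ(∏_ν X_ν^{n_ν}) = Σ_ν ρ(X_ν^{n_ν})` for simple pairwise non-isogenous `X_ν`,
`finrank_neronSeveriGroup_powers`) and `ComplexTorusPicardNumberSecondGap.lean` (Cor. 2.6 for an abstract
elliptic curve: `ρ(Eᵏ) = k²` with complex multiplication, `= C(k+1, 2)` without,
`finrank_neronSeveriGroup_pow_of_cm` / `finrank_neronSeveriGroup_pow_of_not_cm`); the CM curves
`E_{i√p}` and their pairwise non-isogeny for distinct primes come from
`ComplexTorusPicardNumberFiniteProduct.lean` (`not_isIsogenous_ellipticPeriod_I_mul_sqrt`).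

Source followed, verbatim (K. Hulek, R. Laface, *On the Picard numbers of abelian varieties*, Ann. Sc.
Norm. Super. Pisa Cl. Sci. (5) XIX (2019); held text `paper:arxiv-1703.05882` p0011):
"**Proposition 6.4.** Given `g ≥ 2`, consider the set `R_g` of Picard numbers of abelian varieties of
dimension `g`. Then, `{1, …, 2g} ⊂ R_g`. […] **Remark 6.5.** In fact, it is not hard to prove that all
Picard numbers `ρ` satisfying the inequality `g ≤ ρ ≤ 2g` are attained by products of elliptic curves."
(§2.2 Cor. 2.6: "`ρ(E^k) = ½ k(k+1)` (`E` has no CM), `k²` (`E` has CM)"; §6.1: "if `E` and `E'` have CM,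
then they are mutually isogenous if and only if `F ≅ F'` […] infinitely many isogeny classes of non-CM
elliptic curves".)

## The configurations (Remark 6.5 made explicit)

With `t = ρ − g ∈ [0, g]`, pairwise distinct primes `p_0, p_1, …` (`Nat.nth Nat.Prime`), the CM curves
`E_{i√p}` (`dim_ℚ End_ℚ = 2`, pairwise non-isogenous since `√(pq) ∉ ℚ`) and ONE curve without complex
multiplication `E_θ`, `θ = i·2^{1/4}` (`θ² = −√2`, so a relation `θ² + aθ + b = 0` over `ℚ` would put
`√2 ∈ ℚ`; `E_θ` is isogenous to no CM curve since `dim_ℚ End_ℚ` is an isogeny invariant):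
* `t` even: `∏_{j<t/2} E_{i√p_j}² × ∏_{k<g−t} E_{i√p_{t/2+k}}` — `ρ = 4·(t/2) + (g−t) = g + t`;
* `t` odd, `t < g`: `E_θ² × ∏_{j<(t−1)/2} E_{i√p_j}² × ∏_{k} E_{i√p_k}` — `ρ = 3 + 2(t−1) + (g−1−t) = g + t`;
* `t = g` odd: `E_θ³ × ∏_{j<(g−3)/2} E_{i√p_j}²` — `ρ = 6 + 2(g−3) = 2g`.
Each is a Poincaré decomposition (simple = elliptic factors, pairwise non-isogenous, exponents `≥ 1`,
`Σ n_ν = g`), and its Picard number is computed by Cor. 2.3 (as printed) and Cor. 2.6.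

## Contents (theorems only; no definition, no named fact, net debt 0)

* §1 the curves: `im_I_mul_sqrt_nth_prime_pos`, **`finrank_endAlgRat_ellipticPeriod_I_mul_sqrt_nth_prime`**
  (`E_{i√p}` is CM), **`not_isIsogenous_ellipticPeriod_I_mul_sqrt_nth_prime`** (distinct primes),
  `im_I_mul_sqrt_sqrt_two_pos`, **`finrank_endAlgRat_ellipticPeriod_I_mul_sqrt_sqrt_two_ne_two`**
  (`E_{i·2^{1/4}}` has no CM), `not_isIsogenous_ellipticPeriod_I_mul_sqrt_sqrt_two_I_mul_sqrt_nth_prime`.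
* §2 the configurations and their Picard numbers: **`finrank_neronSeveriGroup_cmConfig`**
  (index `Fin u ⊕ Fin s`: `ρ = 4u + s`, `Σ n = 2u + s`, pairwise non-isogenous) and
  **`finrank_neronSeveriGroup_mixedConfig`** (index `Option (Fin u ⊕ Fin s)`, `E_θ^b` in front:
  `ρ = C(b+1,2) + 4u + s`, `Σ n = b + 2u + s`).
* §3 **Remark 6.5: `exists_ellipticPowers_finrank_neronSeveriGroup_eq`** — for `g ≥ 2` and
  `g ≤ ρ ≤ 2g` a Poincaré decomposition into pairwise non-isogenous elliptic curves `E_{τ_ν}` (`ν < r`)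
  with exponents `n_ν ≥ 1`, `Σ n_ν = g` and `ρ(∏_ν E_{τ_ν}^{n_ν}) = ρ`; and
  **`exists_abelianVariety_finrank_eq_and_finrank_neronSeveriGroup_eq`** (an abelian variety of dimension
  `g` with Picard number `ρ`, i.e. `[g, 2g] ⊆ R_g`).  Recorded scope: Prop. 6.4's remaining values
  `1 ≤ ρ < g` use simple abelian surfaces / threefolds of Picard number `1`, `2` (very general members of
  `𝒜_g`) and are NOT produced here.

## References

* [HulekLaface2019PicardNumbersAV] K. Hulek, R. Laface, *On the Picard numbers of abelian varieties*,
  Ann. Sc. Norm. Super. Pisa Cl. Sci. (5) XIX (2019) 1199–1224 (arXiv:1703.05882), §2.2 Cor. 2.6,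
  §3.1 Prop. 3.1, §6.1 Prop. 6.2, §6.2 Prop. 6.4 and Remark 6.5.
* [Lange2023AbelianVarietiesComplex] H. Lange, *Abelian Varieties over the Complex Numbers*, Grundlehren
  Text Edition, Springer (2023), §2.4.4 Thm. 2.4.25 (Poincaré's complete reducibility), §2.6.1
  Cor. 2.6.4 and §7.3.3 Exercise (3) (`ρ(E_τⁿ)`), §1.1.6 Exercise (1)(a).
* [Silverman1994] J. H. Silverman, *Advanced Topics in the Arithmetic of Elliptic Curves* (GTM 151, 1994),
  Ch. II Exercise 2.3 (isogeny classes of CM curves; the tree's `isIsogenous_ellipticPeriod_iff_mem_span_one_tau`).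
-/

noncomputable section

open Module Matrix Function
open Complex (I)

namespace Literature.Geometry.Kaehler

namespace ComplexTorus

/-! ## §1 The curves: `E_{i√p}` (`p` prime, complex multiplication) and `E_{i·2^{1/4}}` (none) -/

section Curves

/-- The product of two distinct primes is not a square. [folklore] -/
private theorem not_isSquare_prime_mul_prime {p q : ℕ} (hp : p.Prime) (hq : q.Prime) (hne : p ≠ q) :
    ¬ IsSquare (p * q) := by
  rintro ⟨k, hk⟩
  have hpk : p ∣ k := by
    have : p ∣ k * k := ⟨q, hk.symm⟩
    exact (hp.dvd_mul.1 this).elim id id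
  obtain ⟨t, rfl⟩ := hpk
  have hqt : q = p * (t * t) := by
    have h' : p * q = p * (p * (t * t)) := by rw [hk]; ring
    exact Nat.eq_of_mul_eq_mul_left hp.pos h'
  exact hne ((Nat.prime_dvd_prime_iff_eq hp hq).1 ⟨t * t, hqt⟩)

/-- `(i x).im = x` for real `x`. [folklore] -/
private theorem I_mul_ofReal_im (x : ℝ) : (I * (x : ℂ)).im = x := by simp

/-- The CM points `i√p_k` (`p_k` the `k`-th prime) lie in the upper half plane. [cite: HulekLaface2019PicardNumbersAV, §3.1 Prop. 3.1 (the curves `E`, `E_i` "not pairwise mutually isogeneous")] -/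
theorem im_I_mul_sqrt_nth_prime_pos (k : ℕ) : 0 < (I * (Real.sqrt (Nat.nth Nat.Prime k) : ℂ)).im := by
  rw [I_mul_ofReal_im]
  exact Real.sqrt_pos.2 (by exact_mod_cast (Nat.prime_nth_prime k).pos)

/-- **`E_{i√p}` has complex multiplication**: `dim_ℚ End_ℚ(E_{i√p_k}) = 2` (`(i√p)² + p = 0`).
[cite: HulekLaface2019PicardNumbersAV, §2.2 Cor. 2.6 and §6.1 ("if `E` and `E'` have CM, then they are mutually isogenous iff `F ≅ F'`")] -/
theorem finrank_endAlgRat_ellipticPeriod_I_mul_sqrt_nth_prime (k : ℕ)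
    (h : (I * (Real.sqrt (Nat.nth Nat.Prime k) : ℂ)).im ≠ 0) : finrank ℚ (endAlgRat (ellipticPeriod h)) = 2 := by
  rw [finrank_endAlgRat_ellipticPeriod_eq_two_iff, ComplexTorus.ellipticEnd_ne_bot_iff]
  refine ⟨0, Nat.nth Nat.Prime k, ?_⟩
  have hs : ((Real.sqrt (Nat.nth Nat.Prime k) : ℝ) : ℂ) ^ 2 = ((Nat.nth Nat.Prime k : ℕ) : ℂ) := by
    rw [← Complex.ofReal_pow, Real.sq_sqrt (Nat.cast_nonneg _), Complex.ofReal_natCast]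
  rw [mul_pow, Complex.I_sq, hs]
  push_cast
  ring

/-- **The curves `E_{i√p}`, `E_{i√q}` for distinct primes are not isogenous** (`√(pq) ∉ ℚ`).
[cite: HulekLaface2019PicardNumbersAV, §3.1 Prop. 3.1 ("`E, E_i, E_j` for `i ≠ j` not pairwise mutually isogeneous")] -/
theorem not_isIsogenous_ellipticPeriod_I_mul_sqrt_nth_prime {k l : ℕ} (hkl : k ≠ l)
    (hk : (I * (Real.sqrt (Nat.nth Nat.Prime k) : ℂ)).im ≠ 0) (hl : (I * (Real.sqrt (Nat.nth Nat.Prime l) : ℂ)).im ≠ 0) :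
    ¬ IsIsogenous (ellipticPeriod hk) (ellipticPeriod hl) :=
  not_isIsogenous_ellipticPeriod_I_mul_sqrt
    (not_isSquare_prime_mul_prime (Nat.prime_nth_prime k) (Nat.prime_nth_prime l)
      fun h ↦ hkl (Nat.nth_injective Nat.infinite_setOf_prime h)) hk hl

/-- The point `θ = i · 2^{1/4}` (a curve `E_θ` without complex multiplication) lies in the upper half
plane. [cite: HulekLaface2019PicardNumbersAV, §6.1 ("by removing CM elliptic curves from `𝓜_{1,1}` …")] -/
theorem im_I_mul_sqrt_sqrt_two_pos : 0 < (I * (Real.sqrt (Real.sqrt 2) : ℂ)).im := by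
  rw [I_mul_ofReal_im]
  exact Real.sqrt_pos.2 (Real.sqrt_pos.2 two_pos)

/-- **`E_θ`, `θ = i · 2^{1/4}`, has no complex multiplication** (`θ² = −√2`: a relation
`θ² + aθ + b = 0` over `ℚ` forces `a = 0`, `b = √2 ∈ ℚ`). [cite: HulekLaface2019PicardNumbersAV, §6.1 ("infinitely many isogeny classes of non-CM elliptic curves")] -/
theorem finrank_endAlgRat_ellipticPeriod_I_mul_sqrt_sqrt_two_ne_two (h : (I * (Real.sqrt (Real.sqrt 2) : ℂ)).im ≠ 0) :
    finrank ℚ (endAlgRat (ellipticPeriod h)) ≠ 2 := by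
  intro h2
  obtain ⟨a, b, hab⟩ := (ComplexTorus.ellipticEnd_ne_bot_iff h).1
    ((finrank_endAlgRat_ellipticPeriod_eq_two_iff h).1 h2)
  set x : ℝ := Real.sqrt (Real.sqrt 2) with hxdef
  have hxpos : 0 < x := Real.sqrt_pos.2 (Real.sqrt_pos.2 two_pos)
  have hx2 : x * x = Real.sqrt 2 := Real.mul_self_sqrt (Real.sqrt_nonneg 2)
  have him := congrArg Complex.im hab
  have hre := congrArg Complex.re hab
  simp only [pow_two, Complex.add_im, Complex.mul_im, Complex.I_re, Complex.I_im, Complex.ofReal_re,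
    Complex.ofReal_im, Complex.ratCast_re, Complex.ratCast_im, Complex.mul_re, zero_mul, one_mul, mul_zero,
    sub_zero, zero_add, add_zero, zero_sub, Complex.zero_im, Complex.zero_re, Complex.add_re] at him hre
  -- `hre : -(x x) + b = 0`, hence `√2 = b ∈ ℚ` (and `him : a x = 0` is not even needed)
  have hb : Real.sqrt 2 = (b : ℝ) := by rw [← hx2]; linarith
  exact irrational_sqrt_two ⟨b, hb.symm⟩

/-- Hence **`E_θ` is not isogenous to any CM curve `E_{i√p}`** (`dim_ℚ End_ℚ` is an isogeny invariant).
[cite: HulekLaface2019PicardNumbersAV, §6.1 Prop. 6.2] -/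
theorem not_isIsogenous_ellipticPeriod_I_mul_sqrt_sqrt_two_I_mul_sqrt_nth_prime (k : ℕ)
    (h : (I * (Real.sqrt (Real.sqrt 2) : ℂ)).im ≠ 0) (hk : (I * (Real.sqrt (Nat.nth Nat.Prime k) : ℂ)).im ≠ 0) :
    ¬ IsIsogenous (ellipticPeriod h) (ellipticPeriod hk) := fun hiso ↦
  finrank_endAlgRat_ellipticPeriod_I_mul_sqrt_sqrt_two_ne_two h
    (hiso.finrank_endAlgRat_eq.trans (finrank_endAlgRat_ellipticPeriod_I_mul_sqrt_nth_prime k hk))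

end Curves

/-! ## §2 The configurations `∏_{j<u} E_{i√p_j}² × ∏_{k<s} E_{i√p_{u+k}}` and `E_θ^b × (the same)` -/

section Configurations

variable (u s : ℕ)

/-- The lattice points of the CM configuration: index `x ∈ Fin u ⊕ Fin s ↦ i √p_x` (distinct primes), all in
the upper half plane. [cite: HulekLaface2019PicardNumbersAV, §6.2 Remark 6.5 (the configuration of elliptic curves)] -/
theorem cmConfig_im_pos (x : Fin u ⊕ Fin s) :
    0 < (I * (Real.sqrt (Nat.nth Nat.Prime (finSumFinEquiv x)) : ℂ)).im :=
  im_I_mul_sqrt_nth_prime_pos _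

/-- **The CM configuration `∏_{j<u} E_{i√p_j}² × ∏_{k<s} E_{i√p_{u+k}}` has `Σ n = 2u + s` and
`ρ = 4u + s`** (Cor. 2.3 as printed; `ρ(E²) = 4` for a CM curve, `ρ(E) = 1`).
[cite: HulekLaface2019PicardNumbersAV, §6.2 Remark 6.5 and §2.2 Cor. 2.6] -/
theorem finrank_neronSeveriGroup_cmConfig :
    (∀ x x' : Fin u ⊕ Fin s, x ≠ x' →
      ¬ IsIsogenous (ellipticPeriod (cmConfig_im_pos u s x).ne') (ellipticPeriod (cmConfig_im_pos u s x').ne')) ∧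
    (∑ x : Fin u ⊕ Fin s, (Sum.elim (fun _ ↦ 2) (fun _ ↦ 1) x : ℕ)) = 2 * u + s ∧
    finrank ℤ (neronSeveriGroup (sigmaPiPeriod fun x : Fin u ⊕ Fin s ↦
      powPeriod (ellipticPeriod (cmConfig_im_pos u s x).ne') (Sum.elim (fun _ ↦ 2) (fun _ ↦ 1) x))) = 4 * u + s := by
  have hni : ∀ x x' : Fin u ⊕ Fin s, x ≠ x' →
      ¬ IsIsogenous (ellipticPeriod (cmConfig_im_pos u s x).ne') (ellipticPeriod (cmConfig_im_pos u s x').ne') :=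
    fun x x' hxx' ↦ not_isIsogenous_ellipticPeriod_I_mul_sqrt_nth_prime
      (fun h ↦ hxx' (finSumFinEquiv.injective (Fin.ext h))) _ _
  refine ⟨hni, ?_, ?_⟩
  · rw [Fintype.sum_sum_type]
    simp only [Sum.elim_inl, Sum.elim_inr, Finset.sum_const, Finset.card_univ, Fintype.card_fin,
      smul_eq_mul, mul_one]
    ring
  · rw [finrank_neronSeveriGroup_powers _ _ (fun x ↦ isSimple_ellipticPeriod _)
      (fun x ↦ isAbelianVariety_elliptic (cmConfig_im_pos u s x)) hni, Fintype.sum_sum_type]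
    have h2 : ∀ j : Fin u, finrank ℤ (neronSeveriGroup (powPeriod
        (ellipticPeriod (cmConfig_im_pos u s (Sum.inl j)).ne')
        (Sum.elim (fun _ ↦ 2) (fun _ ↦ 1) (Sum.inl j : Fin u ⊕ Fin s)))) = 4 :=
      fun j ↦ finrank_neronSeveriGroup_pow_of_cm _ (Module.finrank_self ℂ)
        (finrank_endAlgRat_ellipticPeriod_I_mul_sqrt_nth_prime _ _) 2
    have h1 : ∀ k : Fin s, finrank ℤ (neronSeveriGroup (powPeriod
        (ellipticPeriod (cmConfig_im_pos u s (Sum.inr k)).ne')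
        (Sum.elim (fun _ ↦ 2) (fun _ ↦ 1) (Sum.inr k : Fin u ⊕ Fin s)))) = 1 :=
      fun k ↦ finrank_neronSeveriGroup_pow_of_cm _ (Module.finrank_self ℂ)
        (finrank_endAlgRat_ellipticPeriod_I_mul_sqrt_nth_prime _ _) 1
    rw [Finset.sum_congr rfl fun j _ ↦ h2 j, Finset.sum_congr rfl fun k _ ↦ h1 k]
    simp only [Finset.sum_const, Finset.card_univ, Fintype.card_fin, smul_eq_mul, mul_one]
    ring

variable (b : ℕ)

/-- The lattice points of the mixed configuration: `none ↦ θ = i·2^{1/4}`, `some x ↦ i √p_x`, all in the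
upper half plane. [cite: HulekLaface2019PicardNumbersAV, §6.2 Remark 6.5 (the configuration of elliptic curves)] -/
theorem mixedConfig_im_pos (o : Option (Fin u ⊕ Fin s)) :
    0 < (I * (Real.sqrt (o.elim (Real.sqrt 2) fun x ↦ (Nat.nth Nat.Prime (finSumFinEquiv x) : ℝ)) : ℂ)).im := by
  cases o with
  | none => exact im_I_mul_sqrt_sqrt_two_pos
  | some x => exact im_I_mul_sqrt_nth_prime_pos _

/-- **The mixed configuration `E_θ^b × ∏_{j<u} E_{i√p_j}² × ∏_{k<s} E_{i√p_{u+k}}` (`E_θ` without complex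
multiplication) has `Σ n = b + 2u + s` and `ρ = C(b+1, 2) + 4u + s`.**
[cite: HulekLaface2019PicardNumbersAV, §6.2 Remark 6.5 and §2.2 Cor. 2.6] -/
theorem finrank_neronSeveriGroup_mixedConfig :
    (∀ o o' : Option (Fin u ⊕ Fin s), o ≠ o' →
      ¬ IsIsogenous (ellipticPeriod (mixedConfig_im_pos u s o).ne') (ellipticPeriod (mixedConfig_im_pos u s o').ne')) ∧
    (∑ o : Option (Fin u ⊕ Fin s), (o.elim b (Sum.elim (fun _ ↦ 2) (fun _ ↦ 1)) : ℕ)) = b + (2 * u + s) ∧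
    finrank ℤ (neronSeveriGroup (sigmaPiPeriod fun o : Option (Fin u ⊕ Fin s) ↦
      powPeriod (ellipticPeriod (mixedConfig_im_pos u s o).ne') (o.elim b (Sum.elim (fun _ ↦ 2) (fun _ ↦ 1))))) =
      (b + 1).choose 2 + (4 * u + s) := by
  have hni : ∀ o o' : Option (Fin u ⊕ Fin s), o ≠ o' →
      ¬ IsIsogenous (ellipticPeriod (mixedConfig_im_pos u s o).ne') (ellipticPeriod (mixedConfig_im_pos u s o').ne') := by
    rintro (_ | x) (_ | x') hoo'
    · exact absurd rfl hoo'
    · exact not_isIsogenous_ellipticPeriod_I_mul_sqrt_sqrt_two_I_mul_sqrt_nth_prime _ _ _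
    · exact fun h ↦ not_isIsogenous_ellipticPeriod_I_mul_sqrt_sqrt_two_I_mul_sqrt_nth_prime _ _ _
        (IsIsogenous.symm _ _ h)
    · exact not_isIsogenous_ellipticPeriod_I_mul_sqrt_nth_prime
        (fun h ↦ hoo' (congrArg some (finSumFinEquiv.injective (Fin.ext h)))) _ _
  refine ⟨hni, ?_, ?_⟩
  · rw [Fintype.sum_option, Fintype.sum_sum_type]
    simp only [Option.elim_none, Option.elim_some, Sum.elim_inl, Sum.elim_inr, Finset.sum_const,
      Finset.card_univ, Fintype.card_fin, smul_eq_mul, mul_one]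
    ring
  · rw [finrank_neronSeveriGroup_powers _ _ (fun o ↦ isSimple_ellipticPeriod _)
      (fun o ↦ isAbelianVariety_elliptic (mixedConfig_im_pos u s o)) hni, Fintype.sum_option,
      Fintype.sum_sum_type]
    have h0 : finrank ℤ (neronSeveriGroup (powPeriod (ellipticPeriod (mixedConfig_im_pos u s none).ne')
        ((none : Option (Fin u ⊕ Fin s)).elim b (Sum.elim (fun _ ↦ 2) (fun _ ↦ 1))))) = (b + 1).choose 2 :=
      finrank_neronSeveriGroup_pow_of_not_cm _ (Module.finrank_self ℂ)
        (finrank_endAlgRat_ellipticPeriod_I_mul_sqrt_sqrt_two_ne_two _) b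
    have h2 : ∀ j : Fin u, finrank ℤ (neronSeveriGroup (powPeriod
        (ellipticPeriod (mixedConfig_im_pos u s (some (Sum.inl j))).ne')
        ((some (Sum.inl j) : Option (Fin u ⊕ Fin s)).elim b (Sum.elim (fun _ ↦ 2) (fun _ ↦ 1))))) = 4 :=
      fun j ↦ finrank_neronSeveriGroup_pow_of_cm _ (Module.finrank_self ℂ)
        (finrank_endAlgRat_ellipticPeriod_I_mul_sqrt_nth_prime _ _) 2
    have h1 : ∀ k : Fin s, finrank ℤ (neronSeveriGroup (powPeriod
        (ellipticPeriod (mixedConfig_im_pos u s (some (Sum.inr k))).ne')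
        ((some (Sum.inr k) : Option (Fin u ⊕ Fin s)).elim b (Sum.elim (fun _ ↦ 2) (fun _ ↦ 1))))) = 1 :=
      fun k ↦ finrank_neronSeveriGroup_pow_of_cm _ (Module.finrank_self ℂ)
        (finrank_endAlgRat_ellipticPeriod_I_mul_sqrt_nth_prime _ _) 1
    rw [h0, Finset.sum_congr rfl fun j _ ↦ h2 j, Finset.sum_congr rfl fun k _ ↦ h1 k]
    simp only [Finset.sum_const, Finset.card_univ, Fintype.card_fin, smul_eq_mul, mul_one]
    ring

end Configurations

/-! ## §3 Remark 6.5: every `g ≤ ρ ≤ 2g` is the Picard number of a product of `g` elliptic curves -/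

section Range

/-- Relabelling a configuration by `Fin r`. [folklore] -/
private theorem exists_fin_relabel {S : Type} [Fintype S] [DecidableEq S] (τ : S → ℂ) (hτ : ∀ x, 0 < (τ x).im)
    (n : S → ℕ) (hn : ∀ x, 0 < n x)
    (hni : ∀ x x', x ≠ x' → ¬ IsIsogenous (ellipticPeriod (hτ x).ne') (ellipticPeriod (hτ x').ne')) :
    ∃ (r : ℕ) (τ' : Fin r → ℂ) (hτ' : ∀ ν, 0 < (τ' ν).im) (n' : Fin r → ℕ), (∀ ν, 0 < n' ν) ∧
      (∀ ν ν', ν ≠ ν' → ¬ IsIsogenous (ellipticPeriod (hτ' ν).ne') (ellipticPeriod (hτ' ν').ne')) ∧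
      ∑ ν, n' ν = ∑ x, n x ∧
      finrank ℤ (neronSeveriGroup (sigmaPiPeriod fun ν ↦ powPeriod (ellipticPeriod (hτ' ν).ne') (n' ν))) =
        finrank ℤ (neronSeveriGroup (sigmaPiPeriod fun x ↦ powPeriod (ellipticPeriod (hτ x).ne') (n x))) := by
  let e : Fin (Fintype.card S) ≃ S := (Fintype.equivFin S).symm
  refine ⟨Fintype.card S, fun ν ↦ τ (e ν), fun ν ↦ hτ (e ν), fun ν ↦ n (e ν), fun ν ↦ hn (e ν),
    fun ν ν' hνν' ↦ hni _ _ fun h ↦ hνν' (e.injective h), Fintype.sum_equiv e _ _ fun _ ↦ rfl, ?_⟩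
  exact ((isIsomorphic_sigmaPiPeriod_compEquiv (fun x ↦ powPeriod (ellipticPeriod (hτ x).ne') (n x))
    e).isIsogenous.finrank_neronSeveriGroup_eq _ _).symm

/-- **Hulek–Laface 2019, Remark 6.5: "all Picard numbers `ρ` satisfying the inequality `g ≤ ρ ≤ 2g` are
attained by products of elliptic curves"** (`g ≥ 2`; for `g = 1`, `ρ(E) = 1`). For every such `ρ` there
is a Poincaré decomposition into pairwise non-isogenous elliptic curves `E_{τ_ν}` with exponents `n_ν ≥ 1`,
`Σ n_ν = g`, whose product has Picard number `ρ`: with `t = ρ − g`, the configuration is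
`∏_{j<t/2} E_{i√p_j}² × ∏ E_{i√p_k}` (`t` even), `E_θ² × ∏_{j<(t−1)/2} E_{i√p_j}² × ∏ E_{i√p_k}` (`t` odd,
`t < g`) or `E_θ³ × ∏_{j<(g−3)/2} E_{i√p_j}²` (`t = g` odd), `θ = i·2^{1/4}` without complex
multiplication, `p_j` distinct primes — computed by Cor. 2.3 (as printed) and Cor. 2.6.
[cite: HulekLaface2019PicardNumbersAV, §6.2 Remark 6.5 (with Prop. 6.4 "`{1, …, 2g} ⊂ R_g`")] -/
theorem exists_ellipticPowers_finrank_neronSeveriGroup_eq {g ρ : ℕ} (hg : 2 ≤ g) (hgρ : g ≤ ρ) (hρ : ρ ≤ 2 * g) :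
    ∃ (r : ℕ) (τ : Fin r → ℂ) (hτ : ∀ ν, 0 < (τ ν).im) (n : Fin r → ℕ), (∀ ν, 0 < n ν) ∧
      (∀ ν ν', ν ≠ ν' → ¬ IsIsogenous (ellipticPeriod (hτ ν).ne') (ellipticPeriod (hτ ν').ne')) ∧
      ∑ ν, n ν = g ∧
      finrank ℤ (neronSeveriGroup (sigmaPiPeriod fun ν ↦ powPeriod (ellipticPeriod (hτ ν).ne') (n ν))) = ρ := by
  obtain ⟨t, rfl⟩ : ∃ t, ρ = g + t := ⟨ρ - g, by omega⟩
  have htg : t ≤ g := by omega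
  rcases Nat.even_or_odd t with ⟨u, hu⟩ | ⟨u, hu⟩
  · -- `t = 2u`: `u` CM pairs and `g − t` single CM curves
    obtain ⟨hni, hsum, hρ⟩ := finrank_neronSeveriGroup_cmConfig u (g - t)
    obtain ⟨r, τ', hτ', n', hn', hni', hsum', hρ'⟩ := exists_fin_relabel _ (cmConfig_im_pos u (g - t))
      (Sum.elim (fun _ ↦ 2) (fun _ ↦ 1)) (fun x ↦ by cases x <;> simp) hni
    refine ⟨r, τ', hτ', n', hn', hni', ?_, ?_⟩
    · rw [hsum', hsum]; omega
    · rw [hρ', hρ]; omega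
  · rcases Nat.lt_or_ge t g with htl | htl
    · -- `t = 2u + 1 < g`: `E_θ²`, `u` CM pairs, `g − 2 − 2u` singles
      obtain ⟨hni, hsum, hρ⟩ := finrank_neronSeveriGroup_mixedConfig u (g - 2 - 2 * u) 2
      obtain ⟨r, τ', hτ', n', hn', hni', hsum', hρ'⟩ :=
        exists_fin_relabel _ (mixedConfig_im_pos u (g - 2 - 2 * u))
          (fun o ↦ o.elim 2 (Sum.elim (fun _ ↦ 2) (fun _ ↦ 1)))
          (fun o ↦ by
            rcases o with _ | x
            · simp
            · cases x <;> simp) hni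
      refine ⟨r, τ', hτ', n', hn', hni', ?_, ?_⟩
      · rw [hsum', hsum]; omega
      · rw [hρ', hρ]
        have : (2 + 1).choose 2 = 3 := by decide
        omega
    · -- `t = g = 2u + 1`: `E_θ³` and `u − 1 = (g−3)/2` CM pairs
      obtain ⟨hni, hsum, hρ⟩ := finrank_neronSeveriGroup_mixedConfig (u - 1) 0 3
      obtain ⟨r, τ', hτ', n', hn', hni', hsum', hρ'⟩ :=
        exists_fin_relabel _ (mixedConfig_im_pos (u - 1) 0)
          (fun o ↦ o.elim 3 (Sum.elim (fun _ ↦ 2) (fun _ ↦ 1)))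
          (fun o ↦ by
            rcases o with _ | x
            · simp
            · cases x <;> simp) hni
      refine ⟨r, τ', hτ', n', hn', hni', ?_, ?_⟩
      · rw [hsum', hsum]; omega
      · rw [hρ', hρ]
        have : (3 + 1).choose 2 = 6 := by decide
        omega

/-- **Remark 6.5 for the isogeny class: for `g ≥ 2` and `g ≤ ρ ≤ 2g` there is an abelian variety of
dimension `g` — a product of elliptic curves — with Picard number `ρ`** ("`{1, …, 2g} ⊂ R_g`", Prop. 6.4;
the values `1 ≤ ρ < g` need simple abelian varieties of Picard number `1`, `2` and are not produced here).
[cite: HulekLaface2019PicardNumbersAV, §6.2 Prop. 6.4 and Remark 6.5] -/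
theorem exists_abelianVariety_finrank_eq_and_finrank_neronSeveriGroup_eq {g ρ : ℕ} (hg : 2 ≤ g) (hgρ : g ≤ ρ)
    (hρ : ρ ≤ 2 * g) :
    ∃ (r : ℕ) (τ : Fin r → ℂ) (hτ : ∀ ν, 0 < (τ ν).im) (n : Fin r → ℕ),
      IsAbelianVariety (sigmaPiPeriod fun ν ↦ powPeriod (ellipticPeriod (hτ ν).ne') (n ν)) ∧
      finrank ℂ (∀ ν : Fin r, Fin (n ν) → ℂ) = g ∧
      finrank ℤ (neronSeveriGroup (sigmaPiPeriod fun ν ↦ powPeriod (ellipticPeriod (hτ ν).ne') (n ν))) = ρ := by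
  obtain ⟨r, τ, hτ, n, -, -, hsum, hρ'⟩ := exists_ellipticPowers_finrank_neronSeveriGroup_eq hg hgρ hρ
  refine ⟨r, τ, hτ, n, IsAbelianVariety.sigmaPi fun ν ↦ (isAbelianVariety_elliptic (hτ ν)).pow (n ν), ?_, hρ'⟩
  rw [finrank_powers_eq (fun ν ↦ ellipticPeriod (hτ ν).ne') n, ← hsum]
  exact Finset.sum_congr rfl fun ν _ ↦ by rw [Module.finrank_self, mul_one]

end Range

end ComplexTorus

end Literature.Geometry.Kaehler

end
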